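/-
Copyright: lit-balaban Phase-2 proof seat p34 (gen 19).  Statement-level skeleton of a published paper; no proof claims beyond what the
kernel checks below.
-/
import Literature.MathematicalPhysics.QuantumFieldTheory.BalabanImbrieJaffe1984to88.BIJ88NeumannPropagatorActualBackground
import Literature.MathematicalPhysics.QuantumFieldTheory.BalabanImbrieJaffe1984to88.BIJ88NeumannPropagatorWholeTorus
import Literature.MathematicalPhysics.QuantumFieldTheory.BalabanImbrieJaffe1984to88.BIJ85Ineq732SmallFieldRegion
import Literature.MathematicalPhysics.QuantumFieldTheory.BalabanImbrieJaffe1984to88.BIJ85ScalarPropagatorHolderDecay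

/-!
# [BalabanImbrieJaffe1985] §7.3 p. 326 — «The propagators arising from Δ_k(u_k), under the restriction (7.3.1) on the gauge field, also satisfy
# the regularity and decay estimates of [7]» FOR [I]'s OWN WHOLE-TORUS PROPAGATOR `G_k(u_k) = [−Δ_{u_k} + a_kQ_k^*(u_k)Q_k(u_k)]^{−1}` OF (4.6.2)
# AT THE ACTUAL BACKGROUND, IN `k`-UNIFORM OPERATOR (sup-norm) FORM: the [7] (1.10) value and covariant-derivative members
# `‖G_k(u_k)h‖_∞ ≤ N·c₀e^{−δ₀dist(x, supp h)/L^k}‖h‖_∞`, `‖D_{u_k}G_k(u_k)h‖ ≤ √N·c₁e^{−t₀dist/L^k}‖h‖_∞` for EVERY right inverse `G` of p11's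
# operator `opT (Dlin c_phys u_k) (QlinK u_k k) a_k` (p11's `exists_GK`, p33's `closedG`/`allG`, p31's `gLin`), `N = L^{kD}` the normalisation of
# the unweighted `ℓ²` (p33: `G = N·G_k(u)`), hypothesis-free under the printed (7.3.1) with ONE threshold — the operator-form upgrade of p33's
# `BIJ85Claim73PropagatorDecay` (ℓ²-pairing / pointwise-kernel decay members), by the normalisation dictionary to file
# `BIJ88NeumannPropagatorActualBackground`.

T. Bałaban, J. Imbrie, A. Jaffe, *Renormalization of the Higgs model: minimizers, propagators and the stability of mean field theory*, Commun.
Math. Phys. **97** (1985) 299–329 [BalabanImbrieJaffe1985] = [I], §7.3 p. 326 [PDF 28], Sect. 4.6 p. 313 [PDF 15] (4.6.2); [7] = T. Bałaban,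
*Regularity and decay of lattice Green's functions*, Commun. Math. Phys. **89** (1983) 571–597 [Balaban1983RegularityDecay], Theorem p. 573 (1.10).

statement-level skeleton of published theorems with citation tags; proofs where landed; nothing here is a claim about the Yang–Mills mass gap

PDF held: `paper:balaban1985-cmp97-bij-higgs-minimizers` (journal page = PDF page + 298), p. 326 [PDF 28] (re-read this session, text layer),
p. 313 [PDF 15]; `paper:balaban1983-cmp89-regularity-decay` (journal page = PDF page + 570), p. 573 [PDF 3].

CITATION HEADER (lean-in-tree rule).  Part of the lit-balaban TYPED SKELETON (HOME `run/shared/lean/pub/lit-balaban/`), PHASE-2 proof seat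
p34 gen 19 (unit `lit-balaban-p34-g19`; TAKING line HOME/STATUS.md 2026-08-23T08:17:29Z + filing note; free-target protocol G.5-34(d); source:
the C1 owner's G-C1-05 ruling 2026-08-22T08:34:47Z «WHAT REMAINS = for the first form only the TORUS-vs-REGION / contour-convention relation of
HONEST SCOPE (i) (whether [7]'s estimates are also wanted for the WHOLE-TORUS G_k(u_k) of (4.6.2) in the tree's conventions beyond ADDENDUM 6's
decay members …)»).  WHAT IS REPRODUCED: a located MEMBER of row **C1.Eq7.3.1-7.3.2** (owner r15; head unchanged) and of **C1.Eq4.6.2-4.6.4**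
(p11's `exists_GK`): the (1.10) pair for [I]'s (4.6.2) propagator at `u_k`.  No row is restated and no head changes.
USED BY NAME: file `BIJ88NeumannPropagatorActualBackground` (`smallPlaquette_actualBg`: the passage (7.3.1) ⇒ small fine plaquettes of `u_k`),
p27's `BIJ85ScalarPropagatorSupDecay.decay110_smallField_input` and p30's `BIJ85ScalarPropagatorSupDecayDeriv.decay110_smallField_deriv` (the
whole-torus (1.10) members at a general small-plaquette field, counting normalisation), p30's `BIJ85ScalarPropagatorHolderDecay.holder19_smallField`
/ `stairHol` (v1.1 §4), p31's
`BIJ88NeumannPropagatorWholeTorus.ofLp_G_eq_gBox_mulVec` (every right inverse of p11's operator acts as `gBox … univ`), p31's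
`BIJ85Ineq732SmallFieldRegion.gBox_smul` (degree `−2` homogeneity of `G_k(Ω,u)` in `(√a, c)`), p34/p11's `BIJ85CoefficientAk464.aK_eq_aSeq`,
p11's `BIJ85Ineq732Flat.cPhys`/`cPhys_sq`/`cPhys_pos`, `BIJ85ScalarPropagatorTorus.Dlin`/`Dlin_apply`, `BIJ85ScalarForm464.opT`, p33's
`BIJ85Eq454PlaqResidual.actualBgU1`, `BIJ85Claim73AllCouplings.AllIdx`/`allG`/`allG_spec`, pv07's `Params.spacing`/`B1RG242Torus.α`.  Kind: theorems only (no definition, no `Prop`-valued fact).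

THE PRINTED TEXT, verbatim.  [I] p. 313: *"we can also write G_k(u_k) = [−Δ_{u_k} + a_kQ_k^*(u_k)Q_k(u_k)]^{−1}, (4.6.2) where −Δ_{u_k} =
D^*_{u_k}D_{u_k}. (4.6.3)"*; p. 326: *"The propagators arising from Δ_k(u_k), under the restriction (7.3.1) on the gauge field, also satisfy the
regularity and decay estimates of [7]."*; [7] p. 573: *"|(G_k(Ω, A)f)(x)|, |(D^η_{A,μ}G_k(Ω, A)f)(x)| ≦ c₀ exp(−δ₀ dist(x, supp f))‖f‖_∞ (1.10)"*.

THE DICTIONARY (§1).  The tree carries TWO normalisations of the same whole-torus operator: p11's PHYSICAL one `(a, c) = (a_k, c_phys)`,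
`c_phys² = (L^k)²/L^{kD} = η^{D−2}`, `a_k = aK a L k` ([I] (4.6.2) in the unweighted `ℓ²` of the fine torus, `G = N·G_k(u)` with `N = L^{kD}` — p33),
and p31/p34's COUNTING one `(A, ε^{−1}) = (α_kL^{kD}, ε^{−1})`.  With `s = ε^{−1}/c_phys` one has `s·c_phys = ε^{−1}`, `s²·a_k = α_kL^{kD}`
(p31's `e1`/`e2`), `s²·(L^kε)² = L^{kD}` and, by p31's `gBox_smul`, `G^{phys} = s²·G^{counting}`; every right inverse `G` of p11's operator
acts as `G^{phys}` (p31's `ofLp_G_eq_gBox_mulVec`); p11's `Dlin c_phys` is `(c_phys ε)·covD ε^{−1}`, so `D^{phys}G^{phys} = s·D^{counting}G^{counting}`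
with `s·(L^kε) = √(L^{kD})`.

WHAT IS PROVED (0 `sorry`; standard axioms; theorems only).
* §1 `scale_mul_cPhys`, `scale_sq_mul_aK`, `scale_sq_mul_spacing_sq` (`= L^{kD}`), `scale_mul_spacing` (`= √(L^{kD})`) (+ two private `covD` scalings),
  **`gBox_phys_eq_smul_counting`** (`gBox a_k c_phys u k Ω = s²•gBox (α_kL^{kD}) ε⁻¹ u k Ω` on every `k`-block union), **`GK_apply_eq`**
  (`(Gφ)(x) = s²·(G^{counting}_k(T,u)φ)(x)` for every right inverse `G`), **`Dlin_GK_apply_eq`** (`(D_uGφ)(b) = s·(covD ε⁻¹ u (G^{counting}φ))(b)`).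
* §2 **`decay110_GK_actualBg`** — for `D = d ∈ {2,3}`, `L` odd `> 1`, `a > 0`, `𝓅`: `∃ c₁ δ₀ c₀ > 0` such that for every torus, `1 ≤ k ≤ K`,
  `0 < e ≤ 1` with `e𝓅(e) ≤ c₁`, every `v` with (7.3.1), EVERY right inverse `G` of
  `opT (Dlin (cPhys P k) u_k) (QlinK u_k k) (aK a L k)` at `u_k = actualBgU1 hd2 k e v`, every `x` and `φ` with `‖φ‖ ≤ F` supported at
  sup-distance `≥ D_f` from `x`: `‖(Gφ)(x)‖ ≤ L^{kD}·c₀e^{−δ₀D_f/L^k}F`; **`decay110_GK_deriv_actualBg`** — for every bond `⟨x, μ⟩`: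
  `‖(D_{u_k}Gφ)(⟨x,μ⟩)‖ ≤ √(L^{kD})·c₁′e^{−t₀D_f/L^k}F` (ALL bonds of the torus).
* §3 **`decay110_allG_actualBg`** / **`decay110_allG_deriv_actualBg`** — the same two members for p33's propagator of record `allG a ha i`
  (`BIJ85Claim73AllCouplings`: THE inverse (4.6.2) at the actual background of an arbitrary datum `i : AllIdx d L`), via `allG_spec`.
* §4 (v1.1, append-only) **`holder19_GK_actualBg`** — [7] (1.9), the Hölder member of top order `1 + α` (`0 ≤ α < 1`), all pairs `x₀ ≠ x₁`:
  `(L^k/|x₀−x₁|_∞)^α·‖U(Γ_{x₀x₁})(D_{u_k}Gφ)(⟨x₁,μ⟩) − (D_{u_k}Gφ)(⟨x₀,μ⟩)‖ ≤ √(L^{kD})·c₀e^{−t₀D_f/L^k}F` for every right inverse `G` at `u_k`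
  (p30's whole-torus `BIJ85ScalarPropagatorHolderDecay.holder19_smallField` at the actual background, through §1) — with §2 every member of
  [7]'s Theorem that applies to `Ω = T_η` ((1.9), (1.10)) holds for [I]'s own `G_k(u_k)`.
HONEST SCOPE.  (i) In [I]'s η-weighted conventions (`G_k(u_k) = N^{−1}G`, `D^η = L^kD̃`) both members read `≤ O(1)·e^{−δ dist/L^k}‖h‖_∞` — the
factors `N`, `√N` are the unweighted-`ℓ²` bookkeeping of p11's carrier (as in p33's `BIJ85Claim73PropagatorDecay`, HONEST SCOPE (ii)); nothing
sharper (no `|x−y|^{2−d}` diagonal, no Hölder member) is claimed here.  (ii) File 1's scope verbatim: (7.3.1) on all unit plaquettes; «e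
sufficiently small» = `e𝓅(e) ≤ 1/(23D²K)` with p33's all-tori `K_R`; `D ∈ {2,3}`, `L` odd, `1 ≤ k ≤ K` (the members' standing range);
constants existential from `(d, L, a)`; method divergence from [7] (energy / maximum-principle route) as disclosed in the member files.  Literature +
Mathlib only.  Unit `lit-balaban-p34` (literature-prover-lit-balaban-p34-g19-0), 2026-08-23.  NOT summit progress.
-/

open scoped BigOperators ComplexConjugate
open Finset Matrix

namespace Literature.MathematicalPhysics.QuantumFieldTheory.BalabanImbrieJaffe1984to88.BIJ85Claim73PropagatorSupDecay

open Literature.MathematicalPhysics.QuantumFieldTheory.Balaban1983to89 hiding Site Plaq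
open LatticeFieldCalculus (supDist)
open BIJ88Sect3Statements (U1 toC cfg covD)
open BIJ85Sect1Model (U1Field plaq)
open BIJ85Eq454PlaqResidual (actualBgU1)
open BIJ85Claim73AllCouplings (AllIdx allG allG_spec)
open BIJ85ScalarPropagatorTorus (FineSp BondSp Dlin Dlin_apply)
open BIJ85BlockAveragesTorusK (QlinK)
open BIJ85BlockAveragingIneq (three_le_L)
open BIJ85ScalarForm464 (opT)
open BIJ85Ineq732Flat (cPhys cPhys_sq cPhys_pos)
open BIJ88NeumannNoZeroModesTorus (IsBlockUnion isBlockUnion_univ)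
open BIJ88NeumannPropagator227Torus (gBox)
open BIJ88NeumannPropagatorWholeTorus (ofLp_G_eq_gBox_mulVec)
open BIJ85Ineq732SmallFieldRegion (gBox_smul)
open BIJ88NeumannPropagatorActualBackground (smallPlaquette_actualBg)
open BIJ85ScalarPropagatorSupDecay (decay110_smallField_input)
open BIJ85ScalarPropagatorSupDecayDeriv (decay110_smallField_deriv)
open BIJ85ScalarPropagatorHolderDecay (stairHol holder19_smallField)
open Balaban1983to89 renaming Site → TSite, Plaq → TPlaq

noncomputable section

variable {P : Params}

/-! ## §1 The dictionary between the physical and the counting normalisation -/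

/-- kernel: `s·c_phys = ε^{−1}` for `s = ε^{−1}/c_phys`. [cite: BalabanImbrieJaffe1985, (2.2) p.302] -/
theorem scale_mul_cPhys (P : Params) (k : ℕ) : P.eps⁻¹ / cPhys P k * cPhys P k = P.eps⁻¹ :=
  div_mul_cancel₀ _ (cPhys_pos P k).ne'

/-- kernel: `s²·a_k = α_kL^{kD}` (`a_k = aK a L k = aSeq a L k`, `α_k = a_k(L^kε)^{−2}`). [cite: BalabanImbrieJaffe1985, (4.6.2) p.313] -/
theorem scale_sq_mul_aK (P : Params) (a : ℝ) (k : ℕ) :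
    (P.eps⁻¹ / cPhys P k) ^ 2 * BIJ85Sect4Statements.aK a P.L k = B1RG242Torus.α P a k * (P.L : ℝ) ^ (k * P.d) := by
  have hcP := cPhys_pos P k
  have hε := P.eps_pos
  have hL' : (0 : ℝ) < (P.L : ℝ) ^ k := pow_pos P.cast_L_pos _
  have hLd : (0 : ℝ) < (P.L : ℝ) ^ (k * P.d) := pow_pos P.cast_L_pos _
  rw [BIJ85CoefficientAk464.aK_eq_aSeq, B1RG242Torus.α, div_pow, inv_pow, cPhys_sq]
  unfold Params.spacing
  field_simp

/-- kernel: `s²·(L^kε)² = L^{kD}` — the unweighted-`ℓ²` normalisation `N`. [cite: BalabanImbrieJaffe1985, (2.2) p.302] -/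
theorem scale_sq_mul_spacing_sq (P : Params) (k : ℕ) : (P.eps⁻¹ / cPhys P k) ^ 2 * P.spacing k ^ 2 = (P.L : ℝ) ^ (k * P.d) := by
  have hcP := cPhys_pos P k
  have hε := P.eps_pos
  have hL' : (0 : ℝ) < (P.L : ℝ) ^ k := pow_pos P.cast_L_pos _
  have hLd : (0 : ℝ) < (P.L : ℝ) ^ (k * P.d) := pow_pos P.cast_L_pos _
  rw [div_pow, cPhys_sq]
  unfold Params.spacing
  field_simp

/-- kernel: `s·(L^kε) = √(L^{kD})`. [cite: BalabanImbrieJaffe1985, (2.2) p.302] -/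
theorem scale_mul_spacing (P : Params) (k : ℕ) : P.eps⁻¹ / cPhys P k * P.spacing k = Real.sqrt ((P.L : ℝ) ^ (k * P.d)) := by
  have h0 : 0 ≤ P.eps⁻¹ / cPhys P k * P.spacing k :=
    mul_nonneg (div_nonneg (inv_pos.2 P.eps_pos).le (cPhys_pos P k).le) (P.spacing_pos k).le
  rw [← scale_sq_mul_spacing_sq, ← mul_pow, Real.sqrt_sq h0]

/-- kernel: the covariant difference is linear in its normalisation, `covD (s·c) = s·covD c`. [cite: BalabanImbrieJaffe1985, (2.2) p.302] -/
private theorem covD_smul_const (s c : ℝ) (u : PBond P 0 → ℂ) (f : TSite P 0 → ℂ) (b : PBond P 0) :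
    covD (s * c) u f b = (s : ℂ) * covD c u f b := by
  simp only [covD, Complex.ofReal_mul]; ring

/-- kernel: `covD c u (r•f) = r·covD c u f` for a complex scalar. [cite: BalabanImbrieJaffe1985, (2.2) p.302] -/
private theorem covD_const_smul (c : ℝ) (u : PBond P 0 → ℂ) (r : ℂ) (f : TSite P 0 → ℂ) (b : PBond P 0) :
    covD c u (r • f) b = r * covD c u f b := by
  simp only [covD, Pi.smul_apply, smul_eq_mul]; ring

/-- **`G^{phys}_k(Ω,u) = s²·G^{counting}_k(Ω,u)`** on every `k`-block union (`1 ≤ k`, `k ≤ m + K`, `a > 0`): p11's normalisation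
`(a_k, c_phys)` versus p31/p34's `(α_kL^{kD}, ε^{−1})`, by p31's degree-`(−2)` homogeneity `gBox_smul`. [cite: BalabanImbrieJaffe1985, (4.6.2) p.313] -/
theorem gBox_phys_eq_smul_counting {k : ℕ} (hk1 : 1 ≤ k) (hk : 0 + k ≤ P.m + P.K) {a : ℝ} (ha : 0 < a) (U : GaugeField P 0 U1)
    {Ω : Finset (TSite P 0)} (hΩ : IsBlockUnion k Ω) :
    gBox (BIJ85Sect4Statements.aK a P.L k) (cPhys P k) U k Ω =
      (((P.eps⁻¹ / cPhys P k : ℝ) : ℂ) ^ 2) • gBox (B1RG242Torus.α P a k * (P.L : ℝ) ^ (k * P.d)) P.eps⁻¹ U k Ω := by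
  have hs0 : 0 < P.eps⁻¹ / cPhys P k := div_pos (inv_pos.2 P.eps_pos) (cPhys_pos P k)
  have hL : (1 : ℝ) < P.L := by linarith [three_le_L P]
  have haK := (BIJ85CoefficientAk464.aK_pos_le ha hL hk1).1
  have hs2 : (((P.eps⁻¹ / cPhys P k : ℝ) : ℂ) ^ 2) ≠ 0 := pow_ne_zero _ (Complex.ofReal_ne_zero.2 hs0.ne')
  have h := gBox_smul hk hs0.ne' (cPhys_pos P k).ne' haK U hΩ
  rw [scale_mul_cPhys, scale_sq_mul_aK] at h
  rw [h, smul_smul, mul_inv_cancel₀ hs2, one_smul]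

/-- **every right inverse `G` of p11's operator (4.6.2) acts as `s²·G^{counting}_k(T,u)`**: `(Gφ)(x) = s²·(gBox (α_kL^{kD}) ε⁻¹ u k T ·φ)(x)`
(p31's `ofLp_G_eq_gBox_mulVec` + `gBox_phys_eq_smul_counting`). [cite: BalabanImbrieJaffe1985, (4.6.2) p.313] -/
theorem GK_apply_eq {k : ℕ} (hk1 : 1 ≤ k) (hk : 0 + k ≤ P.m + P.K) {a : ℝ} (ha : 0 < a) (U : GaugeField P 0 U1)
    {G : FineSp P 0 →ₗ[ℝ] FineSp P 0}
    (hG : ∀ φ, opT (Dlin (cPhys P k) U) (QlinK U k) (BIJ85Sect4Statements.aK a P.L k) (G φ) = φ) (φ : FineSp P 0) (x : TSite P 0) :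
    (G φ) x = (((P.eps⁻¹ / cPhys P k : ℝ) : ℂ) ^ 2) *
      (gBox (B1RG242Torus.α P a k * (P.L : ℝ) ^ (k * P.d)) P.eps⁻¹ U k univ *ᵥ WithLp.ofLp φ) x := by
  have hL : (1 : ℝ) < P.L := by linarith [three_le_L P]
  have haK := (BIJ85CoefficientAk464.aK_pos_le ha hL hk1).1
  have h := ofLp_G_eq_gBox_mulVec hk (cPhys_pos P k).ne' haK U hG φ
  rw [gBox_phys_eq_smul_counting hk1 hk ha U (isBlockUnion_univ k), smul_mulVec] at h
  have hx := congrFun h x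
  rw [Pi.smul_apply, smul_eq_mul] at hx
  exact hx

/-- **the covariant derivative of `Gφ` in p11's normalisation is `s` times the counting one**:
`(Dlin c_phys u (Gφ))(b) = s·(covD ε⁻¹ u (G^{counting}_k(T,u)φ))(b)`. [cite: BalabanImbrieJaffe1985, (4.6.3) p.313] -/
theorem Dlin_GK_apply_eq {k : ℕ} (hk1 : 1 ≤ k) (hk : 0 + k ≤ P.m + P.K) {a : ℝ} (ha : 0 < a) (U : GaugeField P 0 U1)
    {G : FineSp P 0 →ₗ[ℝ] FineSp P 0}
    (hG : ∀ φ, opT (Dlin (cPhys P k) U) (QlinK U k) (BIJ85Sect4Statements.aK a P.L k) (G φ) = φ) (φ : FineSp P 0) (b : PBond P 0) :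
    Dlin (cPhys P k) U (G φ) b = ((P.eps⁻¹ / cPhys P k : ℝ) : ℂ) *
      covD P.eps⁻¹ (cfg U) (gBox (B1RG242Torus.α P a k * (P.L : ℝ) ^ (k * P.d)) P.eps⁻¹ U k univ *ᵥ WithLp.ofLp φ) b := by
  obtain ⟨s, hs⟩ : ∃ s : ℝ, s = P.eps⁻¹ / cPhys P k := ⟨_, rfl⟩
  have hs0 : 0 < s := by rw [hs]; exact div_pos (inv_pos.2 P.eps_pos) (cPhys_pos P k)
  have hfun : WithLp.ofLp (G φ) =
      ((s : ℂ) ^ 2) • (gBox (B1RG242Torus.α P a k * (P.L : ℝ) ^ (k * P.d)) P.eps⁻¹ U k univ *ᵥ WithLp.ofLp φ) := by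
    funext x; rw [Pi.smul_apply, smul_eq_mul, hs]; exact GK_apply_eq hk1 hk ha U hG φ x
  have hc : cPhys P k = s⁻¹ * P.eps⁻¹ := by
    rw [hs, inv_div, div_mul_cancel₀ _ (inv_ne_zero P.eps_pos.ne')]
  have hsC : (s : ℂ) ≠ 0 := Complex.ofReal_ne_zero.2 hs0.ne'
  have hgoal : Dlin (cPhys P k) U (G φ) b = (s : ℂ) *
      covD P.eps⁻¹ (cfg U) (gBox (B1RG242Torus.α P a k * (P.L : ℝ) ^ (k * P.d)) P.eps⁻¹ U k univ *ᵥ WithLp.ofLp φ) b := by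
    rw [Dlin_apply, hfun, covD_const_smul, hc, covD_smul_const, Complex.ofReal_inv, ← mul_assoc, sq, mul_inv_cancel_right₀ hsC]
  rw [hgoal, hs]

/-! ## §2 The (1.10) members for [I]'s `G_k(u_k)` at the actual background -/

/-- **[7] (1.10), VALUE MEMBER, `k`-UNIFORM OPERATOR FORM, FOR [I]'s WHOLE-TORUS PROPAGATOR `G_k(u_k)` OF (4.6.2) AT THE ACTUAL BACKGROUND
UNDER THE PRINTED (7.3.1).**  For `D = d ∈ {2, 3}`, `L` odd `> 1`, `a > 0`, `𝓅`: there are `c₁ > 0` and `δ₀, c₀ > 0` (from `(d, L, a)`) such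
that for EVERY torus `P` (`P.d = d`, `P.L = L`), every `1 ≤ k ≤ K`, every `0 < e ≤ 1` with `e𝓅(e) ≤ c₁`, every
unit field `v` with (7.3.1), EVERY right inverse `G` of p11's operator `D^*_{u_k}D_{u_k} + a_kQ_k(u_k)^*Q_k(u_k)` at `u_k = actualBgU1 hd2 k e v`
(p11's `exists_GK`, p33's `closedG`/`allG`, p31's `gLin`), every site `x` and every `φ` with `‖φ‖ ≤ F` supported at sup-distance `≥ D_f` from `x`:
`‖(Gφ)(x)‖ ≤ L^{kD}·c₀e^{−δ₀D_f/L^k}·F` — p27's whole-torus member `decay110_smallField_input` at the actual background (file 1's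
`smallPlaquette_actualBg`) through §1 (`s²(L^kε)² = L^{kD}`).
[cite: BalabanImbrieJaffe1985, (7.3.1) p.326 «also satisfy the regularity and decay estimates of [7]», (4.6.2) p.313]
[cite: Balaban1983RegularityDecay, Theorem p.573 (1.10)] -/
theorem decay110_GK_actualBg (d L : ℕ) (hd : 2 ≤ d) (hd3 : d ≤ 3) (hL : Odd L ∧ 1 < L) {a : ℝ} (ha : 0 < a) (pexp : ℝ) :
    ∃ c₁ δ₀ c₀ : ℝ, 0 < c₁ ∧ 0 < δ₀ ∧ 0 < c₀ ∧ ∀ (P : Params) (hPd : P.d = d), P.L = L →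
      ∀ (hd2 : 2 ≤ P.d) (k : ℕ), 1 ≤ k → k ≤ P.K →
      ∀ (e : ℝ), 0 < e → e ≤ 1 → e * (1 + Real.log e⁻¹) ^ pexp ≤ c₁ →
      ∀ (v : U1Field P k), (∀ q : TPlaq P k, ‖((plaq v q : Circle) : ℂ) - 1‖ ≤ e * (1 + Real.log e⁻¹) ^ pexp) →
        ∀ (G : FineSp P 0 →ₗ[ℝ] FineSp P 0),
          (∀ φ, opT (Dlin (cPhys P k) (actualBgU1 hd2 k e v)) (QlinK (actualBgU1 hd2 k e v) k)
            (BIJ85Sect4Statements.aK a P.L k) (G φ) = φ) →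
          ∀ (x : TSite P 0) (φ : FineSp P 0) (F D : ℝ), (∀ y, ‖φ y‖ ≤ F) →
            (∀ y, φ y ≠ 0 → D ≤ B5Ineq137Torus.T P 0 x y) →
            ‖(G φ) x‖ ≤ (P.L : ℝ) ^ (k * P.d) * (c₀ * Real.exp (-(δ₀ * (((P.L : ℝ) ^ k)⁻¹ * D))) * F) := by
  obtain ⟨K, hK1, HK⟩ := smallPlaquette_actualBg (d := d) (L := L) hd pexp
  obtain ⟨δ₀, c₀, hδ₀, hc₀, H⟩ := decay110_smallField_input d L (by omega) hd3 hL ha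
  refine ⟨1 / (23 * (d : ℝ) ^ 2 * K), δ₀, c₀, by positivity, hδ₀, hc₀, ?_⟩
  intro P hPd hPL hd2 k hk1 hkK e he he1 hsm v hv G hG x φ F D hF hsupp
  have hk0 : 0 + k ≤ P.m + P.K := by omega
  have hdr : (P.d : ℝ) = (d : ℝ) := by rw [hPd]
  rw [← hdr] at hsm
  obtain ⟨-, hC, -, h1, -, -, -⟩ := HK P hPd hPL hd2 k hk1 (by omega) e he he1 hsm v hv
  have hb := H P hPd hPL k hk1 hkK (actualBgU1 hd2 k e v) _ hC h1 x (WithLp.ofLp φ) F D (fun y => hF y) (fun y hy => hsupp y hy)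
  have hs0 : 0 ≤ P.eps⁻¹ / cPhys P k := div_nonneg (inv_pos.2 P.eps_pos).le (cPhys_pos P k).le
  calc ‖(G φ) x‖ = (P.eps⁻¹ / cPhys P k) ^ 2 *
        ‖(gBox (B1RG242Torus.α P a k * (P.L : ℝ) ^ (k * P.d)) P.eps⁻¹ (actualBgU1 hd2 k e v) k univ *ᵥ WithLp.ofLp φ) x‖ := by
        rw [GK_apply_eq hk1 hk0 ha _ hG φ x, norm_mul, norm_pow, Complex.norm_real, Real.norm_eq_abs, abs_of_nonneg hs0]
    _ ≤ (P.eps⁻¹ / cPhys P k) ^ 2 * (P.spacing k ^ 2 * (c₀ * Real.exp (-(δ₀ * (((P.L : ℝ) ^ k)⁻¹ * D))) * F)) :=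
        mul_le_mul_of_nonneg_left hb (sq_nonneg _)
    _ = (P.L : ℝ) ^ (k * P.d) * (c₀ * Real.exp (-(δ₀ * (((P.L : ℝ) ^ k)⁻¹ * D))) * F) := by
        rw [← mul_assoc, scale_sq_mul_spacing_sq]

/-- **[7] (1.10), COVARIANT-DERIVATIVE MEMBER, `k`-UNIFORM OPERATOR FORM, FOR [I]'s `G_k(u_k)` OF (4.6.2) AT THE ACTUAL BACKGROUND UNDER THE
PRINTED (7.3.1), EVERY BOND.**  For `D = d ∈ {2, 3}`, `L` odd `> 1`, `a > 0`, `𝓅`: there are `c₁ > 0` and `t₀, c₁′ > 0` (from `(d, L, a)`)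
such that for EVERY torus, every `1 ≤ k ≤ K`, every `0 < e ≤ 1` with `e𝓅(e) ≤ c₁`, every `v` with (7.3.1), EVERY
right inverse `G` of p11's operator at `u_k`, every bond `⟨x, μ⟩` and every `φ` with `‖φ‖ ≤ F` supported at sup-distance `≥ D_f` from `x`:
`‖(D_{u_k}Gφ)(⟨x,μ⟩)‖ ≤ √(L^{kD})·c₁′e^{−t₀D_f/L^k}·F`, `D_{u_k} = Dlin (cPhys P k) u_k` — p30's whole-torus member `decay110_smallField_deriv`
at the actual background (file 1's `smallPlaquette_actualBg`) through §1 (`s·(L^kε) = √(L^{kD})`).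
[cite: BalabanImbrieJaffe1985, (7.3.1) p.326 «also satisfy the regularity and decay estimates of [7]», (4.6.3) p.313]
[cite: Balaban1983RegularityDecay, Theorem p.573 (1.10)] -/
theorem decay110_GK_deriv_actualBg (d L : ℕ) (hd : 2 ≤ d) (hd3 : d ≤ 3) (hL : Odd L ∧ 1 < L) {a : ℝ} (ha : 0 < a) (pexp : ℝ) :
    ∃ c₁ t₀ c₁' : ℝ, 0 < c₁ ∧ 0 < t₀ ∧ 0 < c₁' ∧ ∀ (P : Params) (hPd : P.d = d), P.L = L →
      ∀ (hd2 : 2 ≤ P.d) (k : ℕ), 1 ≤ k → k ≤ P.K →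
      ∀ (e : ℝ), 0 < e → e ≤ 1 → e * (1 + Real.log e⁻¹) ^ pexp ≤ c₁ →
      ∀ (v : U1Field P k), (∀ q : TPlaq P k, ‖((plaq v q : Circle) : ℂ) - 1‖ ≤ e * (1 + Real.log e⁻¹) ^ pexp) →
        ∀ (G : FineSp P 0 →ₗ[ℝ] FineSp P 0),
          (∀ φ, opT (Dlin (cPhys P k) (actualBgU1 hd2 k e v)) (QlinK (actualBgU1 hd2 k e v) k)
            (BIJ85Sect4Statements.aK a P.L k) (G φ) = φ) →
          ∀ (x : TSite P 0) (μ : Fin P.d) (φ : FineSp P 0) (F D : ℝ),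
            (∀ z, ‖φ z‖ ≤ F) → (∀ z, φ z ≠ 0 → D ≤ (supDist x z : ℝ)) →
            ‖Dlin (cPhys P k) (actualBgU1 hd2 k e v) (G φ) (⟨x, μ⟩ : PBond P 0)‖
              ≤ Real.sqrt ((P.L : ℝ) ^ (k * P.d)) * (c₁' * Real.exp (-(t₀ * D / (P.L : ℝ) ^ k)) * F) := by
  obtain ⟨K, hK1, HK⟩ := smallPlaquette_actualBg (d := d) (L := L) hd pexp
  obtain ⟨t₀, c₁', ht₀, hc₁', H⟩ := decay110_smallField_deriv d L hd hd3 hL ha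
  refine ⟨1 / (23 * (d : ℝ) ^ 2 * K), t₀, c₁', by positivity, ht₀, hc₁', ?_⟩
  intro P hPd hPL hd2 k hk1 hkK e he he1 hsm v hv G hG x μ φ F D hF hsupp
  have hk0 : 0 + k ≤ P.m + P.K := by omega
  have hdr : (P.d : ℝ) = (d : ℝ) := by rw [hPd]
  rw [← hdr] at hsm
  obtain ⟨-, hC, -, h1, -, -, -⟩ := HK P hPd hPL hd2 k hk1 (by omega) e he he1 hsm v hv
  have hb := H P hPd hPL k hk1 hkK (actualBgU1 hd2 k e v) _ hC h1 x μ (WithLp.ofLp φ) F D (fun z => hF z)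
    (fun z hz => hsupp z hz)
  have hs0 : 0 ≤ P.eps⁻¹ / cPhys P k := div_nonneg (inv_pos.2 P.eps_pos).le (cPhys_pos P k).le
  calc ‖Dlin (cPhys P k) (actualBgU1 hd2 k e v) (G φ) (⟨x, μ⟩ : PBond P 0)‖
        = P.eps⁻¹ / cPhys P k * ‖covD P.eps⁻¹ (cfg (actualBgU1 hd2 k e v))
          (gBox (B1RG242Torus.α P a k * (P.L : ℝ) ^ (k * P.d)) P.eps⁻¹ (actualBgU1 hd2 k e v) k univ *ᵥ WithLp.ofLp φ) ⟨x, μ⟩‖ := by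
        rw [Dlin_GK_apply_eq hk1 hk0 ha _ hG φ (⟨x, μ⟩ : PBond P 0), norm_mul, Complex.norm_real, Real.norm_eq_abs, abs_of_nonneg hs0]
    _ ≤ P.eps⁻¹ / cPhys P k * (c₁' * P.spacing k * Real.exp (-(t₀ * D / (P.L : ℝ) ^ k)) * F) :=
        mul_le_mul_of_nonneg_left hb hs0
    _ = P.eps⁻¹ / cPhys P k * P.spacing k * (c₁' * Real.exp (-(t₀ * D / (P.L : ℝ) ^ k)) * F) := by ring
    _ = Real.sqrt ((P.L : ℝ) ^ (k * P.d)) * (c₁' * Real.exp (-(t₀ * D / (P.L : ℝ) ^ k)) * F) := by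
        rw [scale_mul_spacing]

/-! ## §3 The same for p33's hypothesis-free family of actual data (`AllIdx`, `allG`) -/

/-- **[7] (1.10), VALUE MEMBER, FOR p33's PROPAGATOR OF RECORD `allG a ha i` — THE inverse (4.6.2) at the actual background of an arbitrary
actual Sect. 7.3 datum `i : AllIdx d L` (any torus of the series, any scale, any coupling `0 < e ≤ 1`, any unit field `v`)** — §2 at `G := allG a ha i`
(`allG_spec`): for `D = d ∈ {2,3}`, `L` odd `> 1`, `a > 0`, `𝓅` there are `c₁ δ₀ c₀ > 0` with `‖(allG a ha i φ)(x)‖ ≤ L^{kD}·c₀e^{−δ₀D_f/L^k}·F` for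
every datum with `k ≤ K`, `e𝓅(e) ≤ c₁` and (7.3.1). [cite: BalabanImbrieJaffe1985, (7.3.1) p.326, (4.6.2) p.313]
[cite: Balaban1983RegularityDecay, Theorem p.573 (1.10)] -/
theorem decay110_allG_actualBg (d L : ℕ) (hd : 2 ≤ d) (hd3 : d ≤ 3) (hL : Odd L ∧ 1 < L) (a : ℝ) (ha : 0 < a) (pexp : ℝ) :
    ∃ c₁ δ₀ c₀ : ℝ, 0 < c₁ ∧ 0 < δ₀ ∧ 0 < c₀ ∧ ∀ (i : AllIdx d L), i.k ≤ i.P.K →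
      i.e * (1 + Real.log i.e⁻¹) ^ pexp ≤ c₁ →
      (∀ q : TPlaq i.P i.k, ‖((plaq i.v q : Circle) : ℂ) - 1‖ ≤ i.e * (1 + Real.log i.e⁻¹) ^ pexp) →
        ∀ (x : TSite i.P 0) (φ : FineSp i.P 0) (F D : ℝ), (∀ y, ‖φ y‖ ≤ F) →
          (∀ y, φ y ≠ 0 → D ≤ B5Ineq137Torus.T i.P 0 x y) →
          ‖(allG a ha i φ) x‖ ≤ (i.P.L : ℝ) ^ (i.k * i.P.d) * (c₀ * Real.exp (-(δ₀ * (((i.P.L : ℝ) ^ i.k)⁻¹ * D))) * F) := by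
  obtain ⟨c₁, δ₀, c₀, hc₁, hδ₀, hc₀, H⟩ := decay110_GK_actualBg d L hd hd3 hL ha pexp
  refine ⟨c₁, δ₀, c₀, hc₁, hδ₀, hc₀, ?_⟩
  intro i hkK hsm hv x φ F D hF hsupp
  exact H i.P i.hd i.hL i.hd2 i.k i.hk1 hkK i.e i.he i.he1 hsm i.v hv (allG a ha i) (fun φ => allG_spec a ha i φ) x φ F D hF hsupp

/-- **[7] (1.10), COVARIANT-DERIVATIVE MEMBER, FOR p33's PROPAGATOR OF RECORD `allG a ha i`**, every bond — §2 at `G := allG a ha i`: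
`‖(Dlin (cPhys P k) u_k (allG a ha i φ))(⟨x,μ⟩)‖ ≤ √(L^{kD})·c₁′e^{−t₀D_f/L^k}·F` for every datum with `k ≤ K`, `e𝓅(e) ≤ c₁` and (7.3.1).
[cite: BalabanImbrieJaffe1985, (7.3.1) p.326, (4.6.3) p.313] [cite: Balaban1983RegularityDecay, Theorem p.573 (1.10)] -/
theorem decay110_allG_deriv_actualBg (d L : ℕ) (hd : 2 ≤ d) (hd3 : d ≤ 3) (hL : Odd L ∧ 1 < L) (a : ℝ) (ha : 0 < a) (pexp : ℝ) :
    ∃ c₁ t₀ c₁' : ℝ, 0 < c₁ ∧ 0 < t₀ ∧ 0 < c₁' ∧ ∀ (i : AllIdx d L), i.k ≤ i.P.K →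
      i.e * (1 + Real.log i.e⁻¹) ^ pexp ≤ c₁ →
      (∀ q : TPlaq i.P i.k, ‖((plaq i.v q : Circle) : ℂ) - 1‖ ≤ i.e * (1 + Real.log i.e⁻¹) ^ pexp) →
        ∀ (x : TSite i.P 0) (μ : Fin i.P.d) (φ : FineSp i.P 0) (F D : ℝ),
          (∀ z, ‖φ z‖ ≤ F) → (∀ z, φ z ≠ 0 → D ≤ (supDist x z : ℝ)) →
          ‖Dlin (cPhys i.P i.k) i.U (allG a ha i φ) (⟨x, μ⟩ : PBond i.P 0)‖
            ≤ Real.sqrt ((i.P.L : ℝ) ^ (i.k * i.P.d)) * (c₁' * Real.exp (-(t₀ * D / (i.P.L : ℝ) ^ i.k)) * F) := by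
  obtain ⟨c₁, t₀, c₁', hc₁, ht₀, hc₁', H⟩ := decay110_GK_deriv_actualBg d L hd hd3 hL ha pexp
  refine ⟨c₁, t₀, c₁', hc₁, ht₀, hc₁', ?_⟩
  intro i hkK hsm hv x μ φ F D hF hsupp
  exact H i.P i.hd i.hL i.hd2 i.k i.hk1 hkK i.e i.he i.he1 hsm i.v hv (allG a ha i) (fun φ => allG_spec a ha i φ) x μ φ F D hF hsupp

/-! ## §4 (v1.1) [7] (1.9): the Hölder member of top order for [I]'s `G_k(u_k)` -/

/-- **[7] (1.9), HÖLDER MEMBER OF TOP ORDER `1 + α` (`0 ≤ α < 1`), `k`-UNIFORM OPERATOR FORM, FOR [I]'s WHOLE-TORUS PROPAGATOR `G_k(u_k)` OF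
(4.6.2) AT THE ACTUAL BACKGROUND UNDER THE PRINTED (7.3.1), ALL PAIRS.**  For `D = d ∈ {2, 3}`, `L` odd `> 1`, `a > 0`, `𝓅`, `0 ≤ α < 1`: there
are `c₁ > 0` and `t₀, c₀ > 0` (from `(d, L, a, α)`) such that for EVERY torus, every `1 ≤ k ≤ K`, every `0 < e ≤ 1` with `e𝓅(e) ≤ c₁`, every `v`
with (7.3.1), EVERY right inverse `G` of p11's operator at `u_k = actualBgU1 hd2 k e v`, every pair `x₀ ≠ x₁`, every direction `μ` and every `φ`
with `‖φ‖ ≤ F` supported at sup-distance `≥ D_f` from both: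
`(L^k/|x₀−x₁|_∞)^α·‖U(Γ_{x₀x₁})·(D_{u_k}Gφ)(⟨x₁,μ⟩) − (D_{u_k}Gφ)(⟨x₀,μ⟩)‖ ≤ √(L^{kD})·c₀e^{−t₀D_f/L^k}F`, `D_{u_k} = Dlin (cPhys P k) u_k`,
`U(Γ_{x₀x₁}) = stairHol u_k x₀ x₁` (p30's shortest staircase transport) — p30's whole-torus member `holder19_smallField` at the actual background
(file 1's `smallPlaquette_actualBg`) through §1 (`Dlin_GK_apply_eq`, `s·(L^kε) = √(L^{kD})`).  With §2 this is [7]'s (1.9)–(1.10) — every member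
that applies to `Ω = T_η` — for [I]'s own `G_k(u_k)`.
[cite: BalabanImbrieJaffe1985, (7.3.1) p.326 «also satisfy the regularity and decay estimates of [7]», (4.6.2)–(4.6.3) p.313]
[cite: Balaban1983RegularityDecay, Theorem p.573 (1.9)] -/
theorem holder19_GK_actualBg (d L : ℕ) (hd : 2 ≤ d) (hd3 : d ≤ 3) (hL : Odd L ∧ 1 < L) {a : ℝ} (ha : 0 < a) (pexp : ℝ)
    {α : ℝ} (hα0 : 0 ≤ α) (hα1 : α < 1) :
    ∃ c₁ t₀ c₀ : ℝ, 0 < c₁ ∧ 0 < t₀ ∧ 0 < c₀ ∧ ∀ (P : Params) (hPd : P.d = d), P.L = L →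
      ∀ (hd2 : 2 ≤ P.d) (k : ℕ), 1 ≤ k → k ≤ P.K →
      ∀ (e : ℝ), 0 < e → e ≤ 1 → e * (1 + Real.log e⁻¹) ^ pexp ≤ c₁ →
      ∀ (v : U1Field P k), (∀ q : TPlaq P k, ‖((plaq v q : Circle) : ℂ) - 1‖ ≤ e * (1 + Real.log e⁻¹) ^ pexp) →
        ∀ (G : FineSp P 0 →ₗ[ℝ] FineSp P 0),
          (∀ φ, opT (Dlin (cPhys P k) (actualBgU1 hd2 k e v)) (QlinK (actualBgU1 hd2 k e v) k)
            (BIJ85Sect4Statements.aK a P.L k) (G φ) = φ) →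
          ∀ (x₀ x₁ : TSite P 0) (μ : Fin P.d), x₀ ≠ x₁ →
          ∀ (φ : FineSp P 0) (F D : ℝ),
            (∀ z, ‖φ z‖ ≤ F) → (∀ z, φ z ≠ 0 → D ≤ (supDist x₀ z : ℝ) ∧ D ≤ (supDist x₁ z : ℝ)) →
            ((P.L : ℝ) ^ k / (supDist x₀ x₁ : ℝ)) ^ α *
                ‖stairHol (actualBgU1 hd2 k e v) x₀ x₁ * Dlin (cPhys P k) (actualBgU1 hd2 k e v) (G φ) (⟨x₁, μ⟩ : PBond P 0) -
                  Dlin (cPhys P k) (actualBgU1 hd2 k e v) (G φ) (⟨x₀, μ⟩ : PBond P 0)‖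
              ≤ Real.sqrt ((P.L : ℝ) ^ (k * P.d)) * (c₀ * Real.exp (-(t₀ * D / (P.L : ℝ) ^ k)) * F) := by
  obtain ⟨K, hK1, HK⟩ := smallPlaquette_actualBg (d := d) (L := L) hd pexp
  obtain ⟨t₀, c₀, ht₀, hc₀, H⟩ := holder19_smallField d L hd hd3 hL ha hα0 hα1
  refine ⟨1 / (23 * (d : ℝ) ^ 2 * K), t₀, c₀, by positivity, ht₀, hc₀, ?_⟩
  intro P hPd hPL hd2 k hk1 hkK e he he1 hsm v hv G hG x₀ x₁ μ hne φ F D hF hsupp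
  have hk0 : 0 + k ≤ P.m + P.K := by omega
  have hdr : (P.d : ℝ) = (d : ℝ) := by rw [hPd]
  rw [← hdr] at hsm
  obtain ⟨-, hC, -, h1, -, -, -⟩ := HK P hPd hPL hd2 k hk1 (by omega) e he he1 hsm v hv
  have hb := H P hPd hPL k hk1 hkK (actualBgU1 hd2 k e v) _ hC h1 x₀ x₁ μ hne (WithLp.ofLp φ) F D (fun z => hF z)
    (fun z hz => hsupp z hz)
  have hs0 : 0 ≤ P.eps⁻¹ / cPhys P k := div_nonneg (inv_pos.2 P.eps_pos).le (cPhys_pos P k).le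
  have hr0 : 0 ≤ ((P.L : ℝ) ^ k / (supDist x₀ x₁ : ℝ)) ^ α :=
    Real.rpow_nonneg (div_nonneg (pow_nonneg P.cast_L_pos.le _) (Nat.cast_nonneg _)) _
  set X : PBond P 0 → ℂ := covD P.eps⁻¹ (cfg (actualBgU1 hd2 k e v))
    (gBox (B1RG242Torus.α P a k * (P.L : ℝ) ^ (k * P.d)) P.eps⁻¹ (actualBgU1 hd2 k e v) k univ *ᵥ WithLp.ofLp φ) with hX
  have hfac : stairHol (actualBgU1 hd2 k e v) x₀ x₁ * Dlin (cPhys P k) (actualBgU1 hd2 k e v) (G φ) (⟨x₁, μ⟩ : PBond P 0) -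
        Dlin (cPhys P k) (actualBgU1 hd2 k e v) (G φ) (⟨x₀, μ⟩ : PBond P 0)
      = ((P.eps⁻¹ / cPhys P k : ℝ) : ℂ) * (stairHol (actualBgU1 hd2 k e v) x₀ x₁ * X ⟨x₁, μ⟩ - X ⟨x₀, μ⟩) := by
    rw [Dlin_GK_apply_eq hk1 hk0 ha _ hG φ (⟨x₁, μ⟩ : PBond P 0), Dlin_GK_apply_eq hk1 hk0 ha _ hG φ (⟨x₀, μ⟩ : PBond P 0)]
    ring
  calc ((P.L : ℝ) ^ k / (supDist x₀ x₁ : ℝ)) ^ α *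
          ‖stairHol (actualBgU1 hd2 k e v) x₀ x₁ * Dlin (cPhys P k) (actualBgU1 hd2 k e v) (G φ) (⟨x₁, μ⟩ : PBond P 0) -
            Dlin (cPhys P k) (actualBgU1 hd2 k e v) (G φ) (⟨x₀, μ⟩ : PBond P 0)‖
        = P.eps⁻¹ / cPhys P k * (((P.L : ℝ) ^ k / (supDist x₀ x₁ : ℝ)) ^ α *
            ‖stairHol (actualBgU1 hd2 k e v) x₀ x₁ * X ⟨x₁, μ⟩ - X ⟨x₀, μ⟩‖) := by
          rw [hfac, norm_mul, Complex.norm_real, Real.norm_eq_abs, abs_of_nonneg hs0]; ring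
    _ ≤ P.eps⁻¹ / cPhys P k * (c₀ * P.spacing k * Real.exp (-(t₀ * D / (P.L : ℝ) ^ k)) * F) :=
          mul_le_mul_of_nonneg_left hb hs0
    _ = P.eps⁻¹ / cPhys P k * P.spacing k * (c₀ * Real.exp (-(t₀ * D / (P.L : ℝ) ^ k)) * F) := by ring
    _ = Real.sqrt ((P.L : ℝ) ^ (k * P.d)) * (c₀ * Real.exp (-(t₀ * D / (P.L : ℝ) ^ k)) * F) := by rw [scale_mul_spacing]

end

end Literature.MathematicalPhysics.QuantumFieldTheory.BalabanImbrieJaffe1984to88.BIJ85Claim73PropagatorSupDecay
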